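import Literature.Geometry.Kaehler.ComplexTorusLefschetzSL2ActionLattices
import HarnessLib

/-!
# The divided powers `Λ_η^{[j]} = Λ_ηʲ/j!` of the dual Lefschetz operator of a PRINCIPALLY polarised complex torus are INTEGRAL:
# `Λʲ/j! (H•(X, ℤ)) ⊆ H•(X, ℤ)` and `Λʲ/j! (Hdg•(X, ℤ)) ⊆ Hdg•(X, ℤ)`; `exp(nΛ) = ρ(1 0 ; n 1)` is integral
# (Beauville 2010, §4 Theorem: "`(1 0 ; a 1)·z = d⁻¹ a^g e^{θ/a} ∗ z`", "`Yz = d⁻¹ (θ^{g−1}/(g−1)!) ∗ z`" — for `d = 1` the lower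
# unipotent acts by Pontryagin products with the integral minimal classes `θ^{g−j}/(g−j)!`)

Layer `Literature/Geometry/Kaehler`, namespace `Literature.Geometry.Kaehler.ComplexTorus`; lane `lit-hodgefound` (Track 2 foundations
library), prover seat `lit-hodgefound-p09` (generation 52, row g52-#4). THEOREMS ONLY (no definition, no named fact, no instance, no
notation; D-0026 net debt `0`). Sequel of rows g52-#1 `ComplexTorusLefschetzSL2ActionLattices` (the lattices `H•(X, ℤ) = Π_m integralForms`,
`Hdg•(X, ℤ)`; `η^{∧j}/j! ∧ ·` integral; `SL₂(ℤ)` preserves `H•(X, ℤ)` for a p.p.a.v.) and g51-#5 `ComplexTorusWeylOperatorIntegral`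
(`w : Hᵏ(X, ℤ) ⥲ H^{2g−k}(X, ℤ)` for a principal polarisation).

SETTING. `X = E/Φ(ℤ^ι)`, `η` a non-degenerate real `2`-form, `(L_η, Λ_η, H)` its Lefschetz `𝔰𝔩₂`-triple on `H•(X; ℂ) = GForm E ℂ`
(`lefschetzG`, `lefschetzDualG`, `countingG`), `w` the Weyl operator, `Λ_ηʲ = lefschetzDualG η ^ j` (an endomorphism of all degrees at once,
`(Λʲ w)_m = Λ⋯Λ(w_{m+2j})`), `H•(X, ℤ) = AddSubgroup.pi univ (integralForms Φ)`, `Hdg•(X, ℤ) = AddSubgroup.pi univ (m ↦ ⨆_p integralHodgeClassesIn Φ m p)`.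

THE ARGUMENT (Beauville's fourth value read for `d = 1`, through the Weyl element instead of the Pontryagin product). `w L_η = −Λ_η w`
(abstract `weylOperator_mul_e`), hence **`Λ_ηʲ ∘ w = (−1)ʲ w ∘ L_ηʲ`** (§1); for a principal polarisation `w` is a bijection
`Hᵏ(X, ℤ) ⥲ H^{2g−k}(X, ℤ)` (row g51-#5), so every integral `y` is `w(x)` with `x` integral and
`Λʲ/j! (y) = (−1)ʲ w(η^{∧j}/j! ∧ x)` is integral because `η^{∧j}/j! ∧ x` is (row g52-#1 §0, Poincaré's formula) and `w` is. In Beauville's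
language: `Yʲ/j! = d⁻¹ (θ^{g−j}/(g−j)!) ∗ ·` is the Pontryagin product with a minimal class, integral for `d = 1`.

## What is proved

* §1 `lefschetzDualG_pow_weylOperator_apply` (**`Λʲ(w X) = (−1)ʲ w(Lʲ X)`**, any non-degenerate `η`), `lefschetzDualG_pow_mem_rationalEnd` /
  `inv_factorial_smul_lefschetzDualG_pow_mem_rationalEnd` (`Λʲ/j!` is a rational operator for `η ∈ NS_ℚ(X)`).
* §2 **`IsPrincipalPolarization.weylOperator_of_mem_pi_integralForms`** (`w(Hᵏ(X, ℤ)) ⊆ H•(X, ℤ)`, all `k`, no frame in the statement),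
  **`IsPrincipalPolarization.inv_factorial_smul_lefschetzDualG_pow_of_mem_pi_integralForms`** (`Λʲ/j! (Hᵐ(X, ℤ)) ⊆ H•(X, ℤ)`) and
  **`IsPrincipalPolarization.inv_factorial_smul_lefschetzDualG_pow_apply_mem_pi_integralForms`: `Λʲ/j! (H•(X, ℤ)) ⊆ H•(X, ℤ)`** —
  THE DIVIDED POWERS OF `Λ_θ` ARE INTEGRAL ON A P.P.A.V.; `IsPrincipalPolarization.lefschetzDualG_pow_apply_mem_pi_integralForms` (`Λʲ` itself).
* §3 the same on the integral Hodge lattice: `IsPrincipalPolarization.weylOperator_of_mem_pi_iSup_integralHodgeClassesIn`,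
  **`IsPrincipalPolarization.inv_factorial_smul_lefschetzDualG_pow_apply_mem_pi_iSup_integralHodgeClassesIn`: `Λʲ/j! (Hdg•(X, ℤ)) ⊆ Hdg•(X, ℤ)`**.
* §4 **`IsPrincipalPolarization.exp_smul_lefschetzDualG_apply_mem_pi_integralForms`: `exp(nΛ_η) = ρ(1 0 ; n 1)` preserves `H•(X, ℤ)`** for every
  `n ∈ ℤ` (row g52-#1: `SL₂(ℤ)` does; Beauville's `(1 0 ; a 1)·z = d⁻¹ a^g e^{θ/a} ∗ z`).

## Sources, VERBATIM

* A. Beauville, *The action of SL₂ on abelian varieties*, J. Ramanujan Math. Soc. 25 (2010) [Beauville2010SL2], §4 Theorem (held text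
  `paper:arxiv-0805.1541` p0005): "`(1 0 ; a 1)·z = d⁻¹ a^g e^{θ/a} ∗ z`. The corresponding action of the Lie algebra `𝔰𝔩₂` is given by:
  `Xz = θz`, `Yz = d⁻¹ (θ^{g−1}/(g−1)!) ∗ z`, `Hz = (2p−g−s) z`"; §2 Proposition: "There is a (unique) group homomorphism `SL₂(ℤ) → Corr(A)^*`
  mapping `u` to `Δ_* e^θ` and `w` to `d⁻¹ e^℘`."
* H. Lange, *Abelian Varieties over the Complex Numbers* (2023) [Lange2023AbelianVarietiesComplex], §2.5.3 Thm. 2.5.16 and §4.2 (Poincaré's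
  formula: the classes `θ^{g−j}/(g−j)!` are integral), §2.5.3 Prop. 2.5.13 (the Pontryagin product on `H•(X, ℤ) = ⋀•Λ`), §6.2.4 Prop. 6.2.20 p. 310
  (`F : Hᵖ(X, ℤ) ⥲ H^{2g−p}(X̂, ℤ)`).
* Y. André, *Pour une théorie inconditionnelle des motifs* (1996) [Andre1996Motifs], §1.2 (p. 11): `w` conjugates `L` into `−ᶜΛ`.
* A. Polishchuk, *Fourier-stable subrings in the Chow rings of abelian varieties* (2007) [Polishchuk2007FourierStable], §1 (p. 3): "`f(x) =
  (d^{g−1}/((g−1)! χ(d))) ∗ x`", "`F_d f F_d⁻¹ = −e`".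
-/

noncomputable section

-- `Module ℂ` / `SMulZeroClass ℂ` synthesis on `E [⋀^Fin k]→L[ℝ] ℂ` (as in `ComplexTorusLefschetzDecomposition`)
set_option maxSynthPendingDepth 3

namespace Literature.Geometry.Kaehler

namespace ComplexTorus

open Module Function Finset
open scoped MatrixGroups
open Literature.LinearAlgebra.Alternating Literature.Algebra.Lie

universe uE

/-! ## §1 `Λʲ ∘ w = (−1)ʲ w ∘ Lʲ`; `Λʲ/j!` is a rational operator -/

section Conjugation

variable {ι : Type*} [Fintype ι] [DecidableEq ι] {E : Type uE} [NormedAddCommGroup E] [NormedSpace ℂ E] [FiniteDimensional ℂ E]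
  [Nontrivial E] (Φ : (ι → ℝ) ≃L[ℝ] E) {η : E [⋀^Fin 2]→L[ℝ] ℝ}

omit [Fintype ι] [DecidableEq ι] in
/-- **`Λ_ηʲ(w X) = (−1)ʲ · w(L_ηʲ X)`** for every `X ∈ H•(X; ℂ)`: the Weyl operator conjugates `L_η` into `−Λ_η` (`w L = −Λ w`, abstract row
g31-#1 `weylOperator_mul_e`, iterated). [cite: Andre1996Motifs, §1.2 (p. 11)] [cite: Polishchuk2007FourierStable, §1 (p. 3, "F_d f F_d⁻¹ = −e")] -/
theorem lefschetzDualG_pow_weylOperator_apply (hη : ∀ v : E, v ≠ 0 → ∃ w : E, η ![v, w] ≠ 0) (j : ℕ) (X : GForm E ℂ) :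
    (lefschetzDualG η ^ j) ((hasLefschetzProperty_lefschetzG hη).weylOperator isZGrading_countingG X) =
      ((-1 : ℂ) ^ j) • (hasLefschetzProperty_lefschetzG hη).weylOperator isZGrading_countingG ((lefschetzG η ^ j) X) := by
  induction j generalizing X with
  | zero => rw [pow_zero, pow_zero, pow_zero, Module.End.one_apply, Module.End.one_apply, one_smul]
  | succ j ih =>
    have h1 := LinearMap.congr_fun ((hasLefschetzProperty_lefschetzG hη).weylOperator_mul_e isZGrading_countingG) ((lefschetzG η ^ j) X)
    rw [dual_lefschetzG_eq_lefschetzDualG hη, Module.End.mul_apply, LinearMap.neg_apply, Module.End.mul_apply] at h1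
    have h2 : lefschetzDualG η ((hasLefschetzProperty_lefschetzG hη).weylOperator isZGrading_countingG ((lefschetzG η ^ j) X)) =
        -(hasLefschetzProperty_lefschetzG hη).weylOperator isZGrading_countingG (lefschetzG η ((lefschetzG η ^ j) X)) := by
      rw [h1, neg_neg]
    rw [pow_succ', Module.End.mul_apply, ih, map_smul, h2, pow_succ' (lefschetzG η) j, Module.End.mul_apply, smul_neg,
      pow_succ (-1 : ℂ) j, mul_neg_one, neg_smul]

/-- **`Λ_ηʲ` is a rational operator** for `η ∈ NS_ℚ(X)` non-degenerate (`Λ_η ∈ 𝔤𝔩(H•(X; ℚ))`, a `ℚ`-subalgebra).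
[cite: Beauville2010SL2, §4 Theorem ("Yz = d⁻¹ (θ^{g−1}/(g−1)!) ∗ z")] -/
theorem lefschetzDualG_pow_mem_rationalEnd (hQ : η ∈ neronSeveriQ Φ) (hη : ∀ v : E, v ≠ 0 → ∃ w : E, η ![v, w] ≠ 0) (j : ℕ) :
    lefschetzDualG η ^ j ∈ rationalEnd Φ :=
  pow_mem (lefschetzDualG_mem_rationalEnd Φ hQ hη) j

/-- **`Λ_ηʲ/j!` is a rational operator** for `η ∈ NS_ℚ(X)` non-degenerate. [cite: Beauville2010SL2, §4 Theorem] -/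
theorem inv_factorial_smul_lefschetzDualG_pow_mem_rationalEnd (hQ : η ∈ neronSeveriQ Φ) (hη : ∀ v : E, v ≠ 0 → ∃ w : E, η ![v, w] ≠ 0)
    (j : ℕ) : ((j.factorial : ℕ) : ℂ)⁻¹ • lefschetzDualG η ^ j ∈ rationalEnd Φ := by
  have h := ratCast_smul_mem_rationalEnd Φ (lefschetzDualG_pow_mem_rationalEnd Φ hQ hη j) ((j.factorial : ℚ)⁻¹)
  rwa [← Complex.coe_smul, Complex.ofReal_ratCast, Rat.cast_inv, Rat.cast_natCast] at h

end Conjugation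

/-! ## §2 Principal polarisations: `w`, `Λʲ` and `Λʲ/j!` preserve `H•(X, ℤ)` -/

section Principal

variable {ι : Type*} [Fintype ι] [LinearOrder ι] {E : Type uE} [NormedAddCommGroup E] [NormedSpace ℂ E] [FiniteDimensional ℂ E]
  [Nontrivial E] (Φ : (ι → ℝ) ≃L[ℝ] E) {η : E [⋀^Fin 2]→L[ℝ] ℝ}

include Φ in
omit [LinearOrder ι] [Nontrivial E] in
/-- Forms of degree `> 2g = rk Λ` vanish. [cite: Lange2023AbelianVarietiesComplex, §1.1.3 Cor. 1.1.19] -/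
private theorem eq_zero_of_card_lt₆₄ {k : ℕ} (x : E [⋀^Fin k]→L[ℝ] ℂ) (hk : Fintype.card ι < k) : x = 0 := by
  refine eq_zero_of_finrank_real_lt x ?_
  have h := finrank_complex_mul_two Φ (Fintype.equivFin ι).symm
  rw [finrank_real_of_complex]
  omega

omit [Fintype ι] [LinearOrder ι] [FiniteDimensional ℂ E] [Nontrivial E] in
/-- `±T` lies in an additive subgroup with `T`. [folklore] -/
private theorem neg_one_pow_smul_mem₆₄ {S : AddSubgroup (GForm E ℂ)} {T : GForm E ℂ} (hT : T ∈ S) (j : ℕ) : ((-1 : ℂ) ^ j) • T ∈ S := by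
  rcases Nat.even_or_odd j with hj | hj
  · rw [hj.neg_one_pow, one_smul]; exact hT
  · rw [hj.neg_one_pow, neg_one_smul]; exact S.neg_mem hT

/-- **`w(Hᵏ(X, ℤ)) ⊆ H•(X, ℤ)` for a principal polarisation** (row g51-#5 in the lattice vocabulary of row g52-#1, every degree `k`, no frame in the
statement: `w = (−1)^g φ_H^* ∘ F`, Lange's `F : Hᵏ(X, ℤ) ⥲ H^{2g−k}(X̂, ℤ)`). [cite: Lange2023AbelianVarietiesComplex, §6.2.4 Prop. 6.2.20 p. 310]
[cite: Beauville2010SL2, §2 Proposition ("w ↦ d⁻¹ e^℘", d = 1)] -/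
theorem IsPrincipalPolarization.weylOperator_of_mem_pi_integralForms (hp : IsPrincipalPolarization Φ η)
    (hη : ∀ v : E, v ≠ 0 → ∃ w : E, η ![v, w] ≠ 0) {k : ℕ} {x : E [⋀^Fin k]→L[ℝ] ℂ} (hx : x ∈ integralForms Φ k) :
    (hasLefschetzProperty_lefschetzG hη).weylOperator isZGrading_countingG (GForm.of k x) ∈ AddSubgroup.pi Set.univ (integralForms Φ) := by
  obtain ⟨G, hG⟩ := hp.isRiemannForm.exists_intMatrix_latticeGram
  by_cases hk : k ≤ Fintype.card ι
  · obtain ⟨y, hy, hxy⟩ := hp.exists_mem_integralForms_weylOperator_of_eq Φ hη hG (Fintype.equivFin ι).symm (Nat.add_sub_cancel' hk) hx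
    rw [hxy]
    exact of_mem_pi_integralForms Φ hy
  · rw [eq_zero_of_card_lt₆₄ Φ x (not_le.1 hk), GForm.of_zero, map_zero]
    exact zero_mem _

/-- **`w(H•(X, ℤ)) ⊆ H•(X, ℤ)` for a principal polarisation** (all degrees at once). [cite: Lange2023AbelianVarietiesComplex, §6.2.4 Prop. 6.2.20 p. 310]
[cite: Beauville2010SL2, §2 Proposition] -/
theorem IsPrincipalPolarization.weylOperator_apply_mem_pi_integralForms (hp : IsPrincipalPolarization Φ η)
    (hη : ∀ v : E, v ≠ 0 → ∃ w : E, η ![v, w] ≠ 0) {w : GForm E ℂ} (hw : w ∈ AddSubgroup.pi Set.univ (integralForms Φ)) :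
    (hasLefschetzProperty_lefschetzG hη).weylOperator isZGrading_countingG w ∈ AddSubgroup.pi Set.univ (integralForms Φ) :=
  apply_mem_pi_integralForms_of_forall_of Φ _ (fun _ _ hx ↦ hp.weylOperator_of_mem_pi_integralForms Φ hη hx) hw

/-- **`Λ_ηʲ/j! (Hᵐ(X, ℤ)) ⊆ H•(X, ℤ)` for a principal polarisation**: every integral `y ∈ Hᵐ(X, ℤ)` is `w(x)` with `x ∈ H^{2g−m}(X, ℤ)`
(row g51-#5), and `Λʲ/j! (w x) = (−1)ʲ w(η^{∧j}/j! ∧ x)` with `η^{∧j}/j! ∧ x` integral (row g52-#1 §0) and `w` integral — Beauville's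
`Yʲ/j! = (θ^{g−j}/(g−j)!) ∗ ·` for `d = 1`. [cite: Beauville2010SL2, §4 Theorem ("(1 0 ; a 1)·z = d⁻¹ a^g e^{θ/a} ∗ z")]
[cite: Lange2023AbelianVarietiesComplex, §2.5.3 Thm. 2.5.16, §4.2; §6.2.4 Prop. 6.2.20 p. 310] -/
theorem IsPrincipalPolarization.inv_factorial_smul_lefschetzDualG_pow_of_mem_pi_integralForms (hp : IsPrincipalPolarization Φ η)
    (hη : ∀ v : E, v ≠ 0 → ∃ w : E, η ![v, w] ≠ 0) (j : ℕ) {m : ℕ} {y : E [⋀^Fin m]→L[ℝ] ℂ} (hy : y ∈ integralForms Φ m) :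
    ((j.factorial : ℕ) : ℂ)⁻¹ • (lefschetzDualG η ^ j) (GForm.of m y) ∈ AddSubgroup.pi Set.univ (integralForms Φ) := by
  obtain ⟨G, hG⟩ := hp.isRiemannForm.exists_intMatrix_latticeGram
  by_cases hm : m ≤ Fintype.card ι
  · obtain ⟨x, hx, hxy⟩ := hp.exists_mem_integralForms_eq_weylOperator_of Φ hη hG (Fintype.equivFin ι).symm
      (Nat.sub_add_cancel hm) hy
    rw [← hxy, lefschetzDualG_pow_weylOperator_apply hη, lefschetzG_pow_of η j rfl x, smul_comm, ← map_smul, ← GForm.of_smul]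
    exact neg_one_pow_smul_mem₆₄ (hp.weylOperator_of_mem_pi_integralForms Φ hη
      (hp.isRiemannForm.isNSForm.inv_natCast_factorial_smul_lefschetzPow_mem_integralForms Φ j rfl hx)) j
  · rw [eq_zero_of_card_lt₆₄ Φ y (not_le.1 hm), GForm.of_zero, map_zero, smul_zero]
    exact zero_mem _

/-- **THE DIVIDED POWERS OF `Λ_θ` ARE INTEGRAL ON A PRINCIPALLY POLARISED COMPLEX TORUS: `Λ_ηʲ/j! (H•(X, ℤ)) ⊆ H•(X, ℤ)`** for every `j`.
[cite: Beauville2010SL2, §4 Theorem ("Yz = d⁻¹ (θ^{g−1}/(g−1)!) ∗ z", "(1 0 ; a 1)·z = d⁻¹ a^g e^{θ/a} ∗ z")]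
[cite: Lange2023AbelianVarietiesComplex, §2.5.3 Thm. 2.5.16, Prop. 2.5.13; §6.2.4 Prop. 6.2.20 p. 310] -/
theorem IsPrincipalPolarization.inv_factorial_smul_lefschetzDualG_pow_apply_mem_pi_integralForms (hp : IsPrincipalPolarization Φ η)
    (hη : ∀ v : E, v ≠ 0 → ∃ w : E, η ![v, w] ≠ 0) (j : ℕ) {w : GForm E ℂ} (hw : w ∈ AddSubgroup.pi Set.univ (integralForms Φ)) :
    ((j.factorial : ℕ) : ℂ)⁻¹ • (lefschetzDualG η ^ j) w ∈ AddSubgroup.pi Set.univ (integralForms Φ) := by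
  rw [← LinearMap.smul_apply]
  exact apply_mem_pi_integralForms_of_forall_of Φ _
    (fun k x hx ↦ by rw [LinearMap.smul_apply]; exact hp.inv_factorial_smul_lefschetzDualG_pow_of_mem_pi_integralForms Φ hη j hx) hw

/-- **`Λ_ηʲ(H•(X, ℤ)) ⊆ H•(X, ℤ)`** for a principal polarisation (`Λʲ = j! · Λʲ/j!`; `j = 1`: `Λ_θ` is an integral operator, row g50-#5).
[cite: Beauville2010SL2, §4 Theorem] [cite: Lange2023AbelianVarietiesComplex, §6.2.4 Prop. 6.2.20 p. 310] -/
theorem IsPrincipalPolarization.lefschetzDualG_pow_apply_mem_pi_integralForms (hp : IsPrincipalPolarization Φ η)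
    (hη : ∀ v : E, v ≠ 0 → ∃ w : E, η ![v, w] ≠ 0) (j : ℕ) {w : GForm E ℂ} (hw : w ∈ AddSubgroup.pi Set.univ (integralForms Φ)) :
    (lefschetzDualG η ^ j) w ∈ AddSubgroup.pi Set.univ (integralForms Φ) := by
  have h := nsmul_mem (hp.inv_factorial_smul_lefschetzDualG_pow_apply_mem_pi_integralForms Φ hη j hw) j.factorial
  rwa [← Nat.cast_smul_eq_nsmul ℂ, smul_smul, mul_inv_cancel₀ (Nat.cast_ne_zero.2 (Nat.factorial_ne_zero j)), one_smul] at h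

end Principal

/-! ## §3 Principal polarisations: `w` and `Λʲ/j!` preserve the integral Hodge lattice `Hdg•(X, ℤ)` -/

section PrincipalHodge

variable {ι : Type*} [Fintype ι] [LinearOrder ι] {E : Type uE} [NormedAddCommGroup E] [NormedSpace ℂ E] [FiniteDimensional ℂ E]
  [Nontrivial E] (Φ : (ι → ℝ) ≃L[ℝ] E) {η : E [⋀^Fin 2]→L[ℝ] ℝ}

/-- **`w(Hdgⁱ(X, ℤ)) ⊆ Hdg•(X, ℤ)` for a principal polarisation** (row g51-#5: `w : Hdg^{2p}(X, ℤ) ⥲ Hdg^{2g−2p}(X, ℤ)`; homogeneous pieces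
`x ∈ H^m(X, ℤ) ∩ H^{i,i}`, zero unless `m = 2i`). [cite: Lange2023AbelianVarietiesComplex, §6.2.4 Prop. 6.2.20 p. 310, Prop. 6.2.21 p. 311]
[cite: Beauville1983FourierChow, §1 Prop. 1 (p. 241)] -/
theorem IsPrincipalPolarization.weylOperator_of_mem_pi_iSup_integralHodgeClassesIn (hp : IsPrincipalPolarization Φ η)
    (hη : ∀ v : E, v ≠ 0 → ∃ w : E, η ![v, w] ≠ 0) {m i : ℕ} {x : E [⋀^Fin m]→L[ℝ] ℂ} (hx : x ∈ integralHodgeClassesIn Φ m i) :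
    (hasLefschetzProperty_lefschetzG hη).weylOperator isZGrading_countingG (GForm.of m x) ∈
      AddSubgroup.pi Set.univ (fun m ↦ ⨆ p, integralHodgeClassesIn Φ m p) := by
  obtain ⟨G, hG⟩ := hp.isRiemannForm.exists_intMatrix_latticeGram
  have hcard := finrank_complex_mul_two Φ (Fintype.equivFin ι).symm
  by_cases him : i + i = m
  · have hm : m = 2 * i := by omega
    by_cases hi : i ≤ finrank ℂ E
    · have hx' : x.domDomCongr (finCongr hm) ∈ integralHodgeClasses Φ i := (domDomCongr_mem_integralHodgeClassesIn_iff Φ hm i x).2 hx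
      obtain ⟨y, hy, hxy⟩ := hp.exists_mem_integralHodgeClasses_weylOperator_of_eq Φ hη hG (Fintype.equivFin ι).symm
        (show 2 * i + 2 * (finrank ℂ E - i) = Fintype.card ι by omega) hx'
      rw [GForm.of_domDomCongr_finCongr hm] at hxy
      rw [hxy]
      exact of_mem_pi_iSup_integralHodgeClassesIn Φ hy
    · have h0 : x = 0 := eq_zero_of_finrank_real_lt x (by rw [finrank_real_of_complex]; omega)
      rw [h0, GForm.of_zero, map_zero]
      exact zero_mem _
  · rw [integralHodgeClassesIn_eq_bot_of_ne Φ him, AddSubgroup.mem_bot] at hx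
    rw [hx, GForm.of_zero, map_zero]
    exact zero_mem _

/-- **`w(Hdg•(X, ℤ)) ⊆ Hdg•(X, ℤ)`** for a principal polarisation. [cite: Lange2023AbelianVarietiesComplex, §6.2.4 Prop. 6.2.20 p. 310, Prop. 6.2.21 p. 311] -/
theorem IsPrincipalPolarization.weylOperator_apply_mem_pi_iSup_integralHodgeClassesIn (hp : IsPrincipalPolarization Φ η)
    (hη : ∀ v : E, v ≠ 0 → ∃ w : E, η ![v, w] ≠ 0) {w : GForm E ℂ} (hw : w ∈ AddSubgroup.pi Set.univ (fun m ↦ ⨆ p, integralHodgeClassesIn Φ m p)) :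
    (hasLefschetzProperty_lefschetzG hη).weylOperator isZGrading_countingG w ∈ AddSubgroup.pi Set.univ (fun m ↦ ⨆ p, integralHodgeClassesIn Φ m p) :=
  apply_mem_pi_iSup_integralHodgeClassesIn_of_forall_of Φ _ (fun _ _ _ hx ↦ hp.weylOperator_of_mem_pi_iSup_integralHodgeClassesIn Φ hη hx) hw

omit [Fintype ι] [LinearOrder ι] [FiniteDimensional ℂ E] [Nontrivial E] in
/-- `±T` lies in an additive subgroup with `T`. [folklore] -/
private theorem neg_one_pow_smul_mem₆₄' {S : AddSubgroup (GForm E ℂ)} {T : GForm E ℂ} (hT : T ∈ S) (j : ℕ) : ((-1 : ℂ) ^ j) • T ∈ S := by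
  rcases Nat.even_or_odd j with hj | hj
  · rw [hj.neg_one_pow, one_smul]; exact hT
  · rw [hj.neg_one_pow, neg_one_smul]; exact S.neg_mem hT

/-- **`Λ_ηʲ/j! (Hdgⁱ(X, ℤ)) ⊆ Hdg•(X, ℤ)` for a principal polarisation** (homogeneous pieces; `y = w(x)` with `x` an integral Hodge class,
`Λʲ/j!(w x) = (−1)ʲ w(η^{∧j}/j! ∧ x)`). [cite: Beauville2010SL2, §4 Theorem] [cite: Lange2023AbelianVarietiesComplex, §6.2.4 Prop. 6.2.20/6.2.21; §7.2.2] -/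
theorem IsPrincipalPolarization.inv_factorial_smul_lefschetzDualG_pow_of_mem_pi_iSup_integralHodgeClassesIn (hp : IsPrincipalPolarization Φ η)
    (hη : ∀ v : E, v ≠ 0 → ∃ w : E, η ![v, w] ≠ 0) (j : ℕ) {m i : ℕ} {y : E [⋀^Fin m]→L[ℝ] ℂ} (hy : y ∈ integralHodgeClassesIn Φ m i) :
    ((j.factorial : ℕ) : ℂ)⁻¹ • (lefschetzDualG η ^ j) (GForm.of m y) ∈ AddSubgroup.pi Set.univ (fun m ↦ ⨆ p, integralHodgeClassesIn Φ m p) := by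
  obtain ⟨G, hG⟩ := hp.isRiemannForm.exists_intMatrix_latticeGram
  have hcard := finrank_complex_mul_two Φ (Fintype.equivFin ι).symm
  by_cases him : i + i = m
  · have hm : m = 2 * i := by omega
    by_cases hi : i ≤ finrank ℂ E
    · have hy' : y.domDomCongr (finCongr hm) ∈ integralHodgeClasses Φ i := (domDomCongr_mem_integralHodgeClassesIn_iff Φ hm i y).2 hy
      obtain ⟨x, hx, hxy⟩ := hp.exists_mem_integralHodgeClasses_eq_weylOperator_of Φ hη hG (Fintype.equivFin ι).symm
        (show 2 * (finrank ℂ E - i) + 2 * i = Fintype.card ι by omega) hy'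
      rw [GForm.of_domDomCongr_finCongr hm] at hxy
      rw [← hxy, lefschetzDualG_pow_weylOperator_apply hη, lefschetzG_pow_of η j rfl x, smul_comm, ← map_smul, ← GForm.of_smul]
      exact neg_one_pow_smul_mem₆₄' (hp.weylOperator_of_mem_pi_iSup_integralHodgeClassesIn Φ hη
        (hp.isRiemannForm.isNSForm.inv_natCast_factorial_smul_lefschetzPow_mem_integralHodgeClassesIn Φ j rfl rfl hx)) j
    · have h0 : y = 0 := eq_zero_of_finrank_real_lt y (by rw [finrank_real_of_complex]; omega)
      rw [h0, GForm.of_zero, map_zero, smul_zero]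
      exact zero_mem _
  · rw [integralHodgeClassesIn_eq_bot_of_ne Φ him, AddSubgroup.mem_bot] at hy
    rw [hy, GForm.of_zero, map_zero, smul_zero]
    exact zero_mem _

/-- **`Λ_ηʲ/j! (Hdg•(X, ℤ)) ⊆ Hdg•(X, ℤ)`: the divided powers of `Λ_θ` preserve the integral Hodge lattice of a principally polarised complex torus.**
[cite: Beauville2010SL2, §4 Theorem] [cite: Lange2023AbelianVarietiesComplex, §6.2.4 Prop. 6.2.20/6.2.21; §7.2.2] -/
theorem IsPrincipalPolarization.inv_factorial_smul_lefschetzDualG_pow_apply_mem_pi_iSup_integralHodgeClassesIn (hp : IsPrincipalPolarization Φ η)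
    (hη : ∀ v : E, v ≠ 0 → ∃ w : E, η ![v, w] ≠ 0) (j : ℕ) {w : GForm E ℂ} (hw : w ∈ AddSubgroup.pi Set.univ (fun m ↦ ⨆ p, integralHodgeClassesIn Φ m p)) :
    ((j.factorial : ℕ) : ℂ)⁻¹ • (lefschetzDualG η ^ j) w ∈ AddSubgroup.pi Set.univ (fun m ↦ ⨆ p, integralHodgeClassesIn Φ m p) := by
  rw [← LinearMap.smul_apply]
  exact apply_mem_pi_iSup_integralHodgeClassesIn_of_forall_of Φ _
    (fun m i x hx ↦ by rw [LinearMap.smul_apply]; exact hp.inv_factorial_smul_lefschetzDualG_pow_of_mem_pi_iSup_integralHodgeClassesIn Φ hη j hx) hw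

end PrincipalHodge

/-! ## §4 `exp(nΛ_η) = ρ(1 0 ; n 1)` is integral for a principal polarisation -/

section Exponential

variable {ι : Type*} [Fintype ι] [LinearOrder ι] {E : Type uE} [NormedAddCommGroup E] [NormedSpace ℂ E] [FiniteDimensional ℂ E]
  [Nontrivial E] (Φ : (ι → ℝ) ≃L[ℝ] E) {η : E [⋀^Fin 2]→L[ℝ] ℝ}

/-- **`exp(nΛ_η)(H•(X, ℤ)) ⊆ H•(X, ℤ)` for a principal polarisation and every `n ∈ ℤ`**: `exp(nΛ_η) = ρ(1 0 ; n 1)` (row g51-#9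
`sl2Rep_lower`) with `(1 0 ; n 1) ∈ SL₂(ℤ)`, which preserves `H•(X, ℤ)` (row g52-#1) — Beauville's "`(1 0 ; a 1)·z = d⁻¹ a^g e^{θ/a} ∗ z`" read
for `d = 1`, `a ∈ ℤ`. [cite: Beauville2010SL2, §2 Proposition and §4 Theorem] [cite: Mukai1981, §3 Thm. 3.13] -/
theorem IsPrincipalPolarization.exp_smul_lefschetzDualG_apply_mem_pi_integralForms (hp : IsPrincipalPolarization Φ η)
    (hη : ∀ v : E, v ≠ 0 → ∃ w : E, η ![v, w] ≠ 0) (n : ℤ) {w : GForm E ℂ} (hw : w ∈ AddSubgroup.pi Set.univ (integralForms Φ)) :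
    letI := Algebra.compHom (Module.End ℂ (GForm E ℂ)) (algebraMap ℚ ℂ)
    IsNilpotent.exp ((n : ℂ) • lefschetzDualG η) w ∈ AddSubgroup.pi Set.univ (integralForms Φ) := by
  let γ : SL(2, ℤ) := ⟨!![1, 0; n, 1], by simp [Matrix.det_fin_two_of]⟩
  have hγ : ((γ : SL(2, ℂ)) : Matrix (Fin 2) (Fin 2) ℂ) = !![1, 0; (n : ℂ), 1] := by
    rw [Matrix.SpecialLinearGroup.coe_matrix_coe]
    ext i j; fin_cases i <;> fin_cases j <;> simp [γ]
  have h := hp.sl2Rep_map_intCast_apply_mem_pi_integralForms Φ hη γ hw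
  rwa [sl2Rep_lower hη _ hγ] at h

end Exponential

end ComplexTorus

end Literature.Geometry.Kaehler

end
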